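import Literature.MathematicalPhysics.QuantumFieldTheory.Balaban1983to89.Node00.HistoryTermDatum214OlderReading

/-!
# BalabanUVNodes ∕ node N22 = NE9 — A6 NOTE ON THE TABLE-GERM JUNCTIONS (modules J68–J74): (i) why the empty level-`0` table of N10's `_succ` rows was NOT taken — with def-W1's
# reading law `MapsToTables` it forces the atoms' parameter space EMPTY; (ii) the law block the junctions DO display (unscaled-field law, `ReadsBy`, `MapsToTables … univ`, atom
# regularity, measurable Wilson part) is INHABITED by a term datum whose older-terms potential READS the history

Cell `pub-ymgap`, HUMAN RULING D-0062 (Track A), R134 seat `pub-ymgap-dag-n22-c` (strategy s1), generation 19, module J75.  THEOREMS ONLY (no `def`, no `sorry`, standard axioms);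
`--kind proof --supports stmt-QuantumFields-27366 --as helper` (K3⁸ `SpineGivenEndpointR13SepCoPHV`), COUNT-NEUTRAL.  Imports def-W1's storey `Node00.HistoryTermDatum214OlderReading`
(through it `…WindowDilated`, `…AdmissibleClass`, `…HistoryTermDatum214`).  Nothing re-declared.

WHY.  Modules J68–J74 instantiate J66 §2 ∕ J65 at def-W1's (2.14) term data read on node N10's table-germ carrier and display, for the older-term side, def-W1's LAWS on the datum and
on the reading atoms (module 106's hypotheses): `UnscaledFieldLawOn χu χcu 𝒲 𝒪 γ`, `ReadsBy 𝒪 Rd`, `(Rd Z t).MapsToTables sp W univ` with windows `W ⊇ sp K (k+1) X`, and (J69∕J72∕J73∕J74)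
the atoms' regularity `CfgContinuous ∕ CfgJointContinuous ∕ KernelBounded C ∕ FiniteMass m` and the measurability of `𝒲` in the field.  Two A6 facts about that block, kernel-checked:
* §1 ★ `isEmpty_params_of_mapsToTables_emptyTable` — THE COST OF THE `_succ` DEVICE: if the level-`0` table is EMPTY (`sp 0 Y₀ = ∅`, the side condition of N10's Summit-side rows
  `norm_ρ_tableGerms_sub_le ∕ _threePoint_le`, module 106 §2) and the atoms obey `MapsToTables sp W 𝔅` with an inhabited window `W` and field set `𝔅`, then the parameter space `S` of the
  atoms is EMPTY (the law is quantified over every atom `(Y, j, X)` including `j = 0` and every `s : S`) — so every read potential vanishes and, under `ReadsBy`, the datum's older-terms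
  potential `𝒪 ≡ 0`: a history-FREE datum.  This is why J68–J74 keep the level-`0` table free and hand J66∕J65 the class `AdmHist ∧ (old 0 = 0)` instead (the level-`0` device).
* §2 ★ `termDataLawBlock_inhabited` — THE DISPLAYED LAW BLOCK IS INHABITED BY HISTORY-READING DATA: for every `c P 𝔸 M k L γ` there are a term datum `𝔇` (def-W1's degenerate witness
  `nonempty_termDatum214` with its boxes, Wilson part and potential REPLACED), unscaled-field data `χu = χcu = 0`, `𝒲 = 0`, `𝒪`, and reading atoms `R Z t` over `S := Unit` (Dirac mass,
  kernel `1`, the zero configuration) such that `UnscaledFieldLawOn χu χcu 𝒲 𝒪 γ`, `ReadsBy 𝒪 R`, `MapsToTables (fun _ _ => univ) W univ` for EVERY window `W`, `CfgContinuous`,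
  `CfgJointContinuous`, `KernelBounded 1`, `FiniteMass 1`, `𝒲` measurable — AND **`𝒪 Z t old ξ Y A = Σ_{j ≤ k} Σ_{X ∈ 𝐃_j} old j X 0`**: the older-terms potential READS every level of
  the history (it separates histories; it is not the zero functional).  The tables here are `univ` at every level (open), so `AdmHist` is inhabited (`zero_mem_AdmHist`) and every
  inclusion `sp K (k+1) X ⊆ W` is available with `W := univ`.
WHAT §2 DOES NOT WITNESS (stated plainly): the per-term (2.26) row `hT` ∕ the located records `hι`, `hloc18`, the numerics, N18's rate, the last-coupling rows — NODE A's ∕ N18's content;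
the witness concerns the LAW block only (the block the LOCATED note of 2026-08-28 22:23Z is about).

HONEST FRAMING (binding).  Bookkeeping: one elementary emptiness lemma and one explicit degenerate-but-history-reading model (Dirac atoms at the zero configuration); NO estimate of
Bałaban's is proved or asserted; nothing of the record is constructed; the model is NOT claimed to be the record's datum.  N22 NOT discharged (typed 28∕28 · discharged 6∕27 UNCHANGED);
K3⁸ OPEN and NOT claimed; NE9 NOT IN PRINT for d = 4; one finite 𝕋⁴ programme at fixed ε — NOTHING about the continuum limit, ℝ⁴, OS axioms, a mass gap or the Clay problem is proved
or claimed.  References (TYPES only): [I] = Bałaban, CMP 109 (1987) (0.23) p. 256, (2.9)–(2.13) pp. 266–268, (3.4) p. 270, (3.10) p. 272, (3.15)–(3.18) p. 273; [II] = CMP 116 (1988)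
(1.33)–(1.35) p. 9, (1.41) p. 11, (2.14) p. 15.
-/

noncomputable section

open Set Metric MeasureTheory
open scoped BigOperators

namespace YMDAG.N22.TermRecursion

open Literature.MathematicalPhysics.QuantumFieldTheory.Balaban1983to89
open Literature.MathematicalPhysics.QuantumFieldTheory.Balaban1983to89.TreeLengthTorus (TDom)
open Literature.MathematicalPhysics.QuantumFieldTheory.Balaban1983to89.Node00
open Literature.MathematicalPhysics.QuantumFieldTheory.Balaban1983to89.Node00.Sect2 (domSys domCount CPair)
open Literature.MathematicalPhysics.QuantumFieldTheory.Balaban1983to89.Node00.W1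

/-! ## §1 The cost of an empty level-`0` table under def-W1's reading law -/

/-- ★ **AN EMPTY LEVEL-`0` TABLE EMPTIES THE ATOMS' PARAMETER SPACE.**  If `sp 0 Y₀ = ∅` for the level-`0` domains and the reading atoms `R` of the slice `(Z, t)` map the configurations of
an inhabited window `W` and an inhabited field set `𝔅` into the tables (`MapsToTables sp W 𝔅` — every atom `(Y, j, X)`, every parameter `s : S`), then `S` is empty: the level-`0`
atom of any `Y`, `Y₀` would have to land in `∅`.  (Hence every read potential is `0` and a datum with `ReadsBy 𝒪 R` is history-free — the reason modules J68–J74 do not use the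
empty-table side condition of N10's `_succ` rows.) [folklore] -/
theorem isEmpty_params_of_mapsToTables_emptyTable {c : B13.Consts} {P : Params} {𝔸 : Type*} {M k L : ℕ} [NeZero L] {𝔇 : TermDatum214 c P 𝔸 M k L}
    {Z : (domSys P M (k + 1)).Dom} {t : TermLabel P M k L} {S : Type*} [MeasurableSpace S] (R : 𝔇.ReadingAtoms Z t S)
    {sp : (j : ℕ) → (domSys P M j).Dom → Set (CPair P 𝔸)} {W : Set (CPair P 𝔸)} {𝔅 : Set ((𝔇.𝒦 Z t).Λ → ℝ)}
    (hmaps : R.MapsToTables sp W 𝔅) (hsp0 : ∀ (Y₀ : (domSys P M 0).Dom), sp 0 Y₀ = ∅) (hW : W.Nonempty) (h𝔅 : 𝔅.Nonempty)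
    (Y : TDom P.d (L * domCount P M (k + 1))) (Y₀ : (domSys P M 0).Dom) : IsEmpty S := by
  obtain ⟨ξ, hξ⟩ := hW
  obtain ⟨A, hA⟩ := h𝔅
  refine ⟨fun s => ?_⟩
  have h := hmaps Y 0 Y₀ ξ hξ A hA s
  simp only [Fin.val_zero, hsp0] at h
  exact h

/-! ## §2 The displayed law block is inhabited by a history-reading datum -/

/-- ★ **THE LAW BLOCK OF MODULES J68–J74 IS INHABITED BY HISTORY-READING DATA** (A6 witness for the LAWS only): starting from def-W1's degenerate datum `nonempty_termDatum214`, replace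
the boxes by `0`, the Wilson part by `0` and the potential by the DILATED-FIELD reading `𝒱 Z t z old φ Y B := 𝒪 Z t old φ Y (Re z • B)` of `𝒪 := readOlder R`, where the atoms `R Z t`
over `S := Unit` carry the Dirac mass, the kernel `1` and the zero configuration: then the unscaled-field law on `]0, γ]`, `ReadsBy`, `MapsToTables (univ tables) W univ` for every `W`,
continuity ∕ joint continuity of the configuration families, `KernelBounded 1`, `FiniteMass 1` and measurability of `𝒲` all hold, AND `𝒪 Z t old ξ Y A = Σ_j Σ_X old j X 0` — the
potential reads every level of the history.  Nothing of NODE A's located content (`hT`, `hι`, `hloc18`) is witnessed. [folklore] -/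
theorem termDataLawBlock_inhabited (c : B13.Consts) (P : Params) (𝔸 : Type) [NormedRing 𝔸] [NormedAlgebra ℂ 𝔸] (M k L : ℕ) [NeZero L] (γ : ℝ) :
    ∃ (𝔇 : TermDatum214 c P 𝔸 M k L) (χu χcu : 𝔇.UnscaledChi) (𝒲 : 𝔇.UnscaledWilson) (𝒪 : 𝔇.UnscaledOlder)
      (R : (Z : (domSys P M (k + 1)).Dom) → (t : TermLabel P M k L) → 𝔇.ReadingAtoms Z t Unit),
      𝔇.UnscaledFieldLawOn χu χcu 𝒲 𝒪 γ ∧ 𝔇.ReadsBy 𝒪 R ∧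
      (∀ (Z : (domSys P M (k + 1)).Dom) (t : TermLabel P M k L) (W : Set (CPair P 𝔸)), (R Z t).MapsToTables (fun _ _ => univ) W univ) ∧
      (∀ (Z : (domSys P M (k + 1)).Dom) (t : TermLabel P M k L), (R Z t).CfgContinuous) ∧
      (∀ (Z : (domSys P M (k + 1)).Dom) (t : TermLabel P M k L), (R Z t).CfgJointContinuous) ∧
      (∀ (Z : (domSys P M (k + 1)).Dom) (t : TermLabel P M k L), (R Z t).KernelBounded 1) ∧
      (∀ (Z : (domSys P M (k + 1)).Dom) (t : TermLabel P M k L), (R Z t).FiniteMass 1) ∧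
      (∀ (Z : (domSys P M (k + 1)).Dom) (t : TermLabel P M k L) (φ : CPair P 𝔸) (Y : TDom P.d (L * domCount P M (k + 1))),
        Measurable fun B : (𝔇.𝒦 Z t).Λ → ℝ => 𝒲 Z t φ Y B) ∧
      (∀ (Z : (domSys P M (k + 1)).Dom) (t : TermLabel P M k L) (old : OlderTerms P 𝔸 M k) (ξ : CPair P 𝔸)
        (Y : TDom P.d (L * domCount P M (k + 1))) (A : (𝔇.𝒦 Z t).Λ → ℝ),
        𝒪 Z t old ξ Y A = ∑ j : Fin (k + 1), ∑ X : (domSys P M j).Dom, old j X 0) := by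
  classical
  -- any term datum (def-W1's degenerate witness), then the ZERO boxes∕Wilson part and the older-terms potential READ by Dirac atoms at the zero configuration
  obtain ⟨𝔇₀⟩ := nonempty_termDatum214 c P 𝔸 M k L
  let R₀ : (Z : (domSys P M (k + 1)).Dom) → (t : TermLabel P M k L) → 𝔇₀.ReadingAtoms Z t Unit := fun Z t =>
    { μ := fun _ _ _ => Measure.dirac (), K := fun _ _ _ _ => 1, cfg := fun _ _ _ _ _ _ => 0 }
  let 𝒪₀ : 𝔇₀.UnscaledOlder := 𝔇₀.readOlder R₀
  let 𝔇 : TermDatum214 c P 𝔸 M k L :=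
    { 𝔇₀ with chiY₀ := fun _ _ _ _ => 0, chicP := fun _ _ _ _ => 0, 𝒱 := fun Z t z old φ Y B => 𝒪₀ Z t old φ Y (z.re • B) }
  -- the same atoms, typed at the new datum (its kernel record is `𝔇₀`'s, so the atom types agree field by field)
  let R : (Z : (domSys P M (k + 1)).Dom) → (t : TermLabel P M k L) → 𝔇.ReadingAtoms Z t Unit := fun Z t =>
    { μ := fun _ _ _ => Measure.dirac (), K := fun _ _ _ _ => 1, cfg := fun _ _ _ _ _ _ => 0 }
  have hpot : ∀ (Z : (domSys P M (k + 1)).Dom) (t : TermLabel P M k L) (old : OlderTerms P 𝔸 M k) (ξ : CPair P 𝔸)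
      (Y : TDom P.d (L * domCount P M (k + 1))) (A : (𝔇₀.𝒦 Z t).Λ → ℝ),
      𝒪₀ Z t old ξ Y A = ∑ j : Fin (k + 1), ∑ X : (domSys P M j).Dom, old j X 0 := by
    intro Z t old ξ Y A
    show (R₀ Z t).potential old ξ Y A = _
    rw [TermDatum214.ReadingAtoms.potential_eq]
    refine Finset.sum_congr rfl fun j _ => Finset.sum_congr rfl fun X _ => ?_
    show ∫ s : Unit, (1 : ℂ) * old j X 0 ∂(Measure.dirac ()) = old j X 0
    rw [integral_dirac, one_mul]
  refine ⟨𝔇, fun _ _ _ => 0, fun _ _ _ => 0, fun _ _ _ _ _ => 0, 𝒪₀, R, ?_, fun _ _ _ _ _ _ => rfl, ?_, ?_, ?_, ?_, ?_, fun _ _ _ _ => measurable_const, hpot⟩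
  · -- the unscaled-field law: zero boxes, zero Wilson part, the potential read at the dilated field
    intro Z t s _
    refine ⟨fun _ => rfl, fun _ => rfl, fun old φ Y B => ?_⟩
    show 𝒪₀ Z t old φ Y (((s : ℝ) : ℂ).re • B) = _
    rw [Complex.ofReal_re, mul_zero, zero_add]
  · intro Z t W Y j X ξ _ A _ s
    exact mem_univ _
  · intro Z t Y j X ξ A
    exact continuous_const
  · intro Z t Y j X ξ
    exact continuous_const
  · intro Z t Y j X
    exact ⟨measurable_const, fun _ => show ‖(1 : ℂ)‖ ≤ 1 by simp⟩
  · intro Z t Y j X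
    show IsFiniteMeasure (Measure.dirac ()) ∧ (Measure.dirac ()).real univ ≤ 1
    exact ⟨inferInstance, by simp⟩

end YMDAG.N22.TermRecursion

end
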